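import Summits.AnomalousDissipation.AnomalousDissipation.Theses.TaylorCertificates
import Summits.AnomalousDissipation.AnomalousDissipation.Theorems.TaylorCertificatePair.Negative.Modes
import Literature.Analysis.FunctionSpaces.TorusFluidGlueProofs

/-!
# Cellular trigonometric quiet points of the EVEN-harmonic Kolmogorov force

Crux `TaylorCertificates.SmoothEulerCoerciveForce` (stmt-AnomalousDissipation-14097), negative side
(cdisprove seat `refuter-cdisprove-stmt-AnomalousDissipation-14097-0`; found by the seat's numerical dodger
search, kit job j013919 target `T7_kolm2`, then identified and certified here).

Mechanism (2½-D, `x₁`-independent): `V = (a(Y,Z), ∂_Zψ, −∂_Yψ)` is divergence free and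
`(V·∇)V = ((β·∇)a, (β·∇)β)` with `β = ∇⊥ψ`; for a single-shell stream function the planar part is a gradient,
and the passive scalar `a` only has to solve the transport equation `β·∇a = f₁`.  For the CELLULAR flow
`ψ = γ cos Y cos Z` and `a = α sin Y cos Z` one gets `β·∇a = −(αγ/2) sin 2Z`: so for all real `α, γ` the
two-mode-pair field
`V_{α,γ} = (α sin Y cos Z, −γ cos Y sin Z, γ sin Y cos Z) = Re(e_{(0,1,1)} • (−iα/2, iγ/2, −iγ/2)) + Re(e_{(0,1,−1)} • (−iα/2, −iγ/2, −iγ/2))`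
is a smooth, divergence-free, MEAN-ZERO quiet Euler point of the second-harmonic Kolmogorov force
`f = −παγ sin(2Z) e₁ = Re(e_{(0,0,2)} • (iπαγ, 0, 0))` (unit torus, `Y = 2πx₂`, `Z = 2πx₃`).
Consequences for the crux: every even harmonic `c·sin(4πk x₃) e₁` of the Kolmogorov profile is excluded as a
witness by an EXPLICIT trigonometric polynomial (take `αγ = −c/π`, rescale `Y,Z ↦ kY,kZ`), again along a
one-parameter family (`α ↦ (α, −c/(πα))`); the odd harmonics are dodged only by the non-polynomial 2½-D
first-integral construction of the crux workfile (F3, paper) — no `x₁`-independent trigonometric dodger exists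
there (streamline obstruction on shear and cellular flows, ibid.).
Template: `Negative/TwoBeltramiDodger.lean`.  No definitions; no statement of the route is asserted.
-/

noncomputable section

open MeasureTheory UnitAddTorus Matrix
open scoped InnerProductSpace ComplexConjugate

namespace Summit.AnomalousDissipation.AnomalousDissipation.Theorems.SmoothEulerCoerciveForce.Negative

open Literature.Analysis.FunctionSpaces
open Summit.AnomalousDissipation.AnomalousDissipation.Theorems.TaylorCertificatePair.Negative

/-- **Weak steady Euler identity for the cellular family.** For all real `α γ` and every smooth divergence-free
test field `w`: `∫ ⟪(V·∇)V − f, w⟫ = 0` with `V = ∑ₘ Re(e_{K m} • Zp m)` (modes `(0,1,±1)`) and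
`f = Re(e_{(0,0,2)} • (iπαγ,0,0))`. -/
theorem cellular_quiet (α γ : ℝ) {K : Fin 2 → Fin 3 → ℤ} {KF : Fin 1 → Fin 3 → ℤ}
    {Zp : Fin 2 → EuclideanSpace ℂ (Fin 3)} {y : EuclideanSpace ℂ (Fin 3)}
    (hK : K = ![![0, 1, 1], ![0, 1, -1]])
    (hZp : Zp = ![WithLp.toLp 2 ![-Complex.I * α / 2, Complex.I * γ / 2, -Complex.I * γ / 2],
      WithLp.toLp 2 ![-Complex.I * α / 2, -Complex.I * γ / 2, -Complex.I * γ / 2]])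
    (hKF : KF = ![![0, 0, 2]]) (hy : y = WithLp.toLp 2 ![Complex.I * Real.pi * α * γ, 0, 0])
    (w : UnitAddTorus (Fin 3) → EuclideanSpace ℝ (Fin 3)) (hws : Torus.IsSmooth w) (hwd : Torus.IsDivFree w) :
    ∫ x, ⟪Torus.convect (∑ mm, Torus.realTrigPoly {K mm} (fun _ => Zp mm))
        (∑ mm, Torus.realTrigPoly {K mm} (fun _ => Zp mm)) x -
        (∑ mm, Torus.realTrigPoly {KF mm} (fun _ => y)) x, w x⟫_ℝ = 0 := by
  have hZp' : ∀ m, ((fun j => ((K m) j : ℂ)) ⬝ᵥ (WithLp.ofLp (Zp m))) = 0 := by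
    intro m; fin_cases m <;> (simp [hK, hZp, dotProduct, Fin.sum_univ_three]; try ring)
  have hvs : Torus.IsSmooth (∑ mm, Torus.realTrigPoly {K mm} (fun _ => Zp mm)) := isSmooth_modes K Zp
  have hvd : Torus.IsDivFree (∑ mm, Torus.realTrigPoly {K mm} (fun _ => Zp mm)) := isDivFree_modes K Zp hZp'
  have hfs : Torus.IsSmooth (∑ mm, Torus.realTrigPoly {KF mm} (fun _ => y)) := isSmooth_modes KF (fun _ => y)
  have hwi : Integrable w volume := hws.integrable
  have h1 : Integrable (fun x => ⟪Torus.convect (∑ mm, Torus.realTrigPoly {K mm} (fun _ => Zp mm))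
      (∑ mm, Torus.realTrigPoly {K mm} (fun _ => Zp mm)) x, w x⟫_ℝ) volume :=
    ((hvs.convect hvs).inner hws).integrable
  have h2 : Integrable (fun x => ⟪(∑ mm, Torus.realTrigPoly {KF mm} (fun _ => y)) x, w x⟫_ℝ) volume :=
    (hfs.inner hws).integrable
  simp_rw [inner_sub_left]
  rw [integral_sub h1 h2]
  rw [Torus.integral_inner_convect_eq_neg hvs hvd hvs hws]
  have hcomm : ∫ x, ⟪(∑ mm, Torus.realTrigPoly {K mm} (fun _ => Zp mm)) x,
        Torus.convect (∑ mm, Torus.realTrigPoly {K mm} (fun _ => Zp mm)) w x⟫_ℝ =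
      ∫ x, ⟪Torus.fderiv w x ((∑ mm, Torus.realTrigPoly {K mm} (fun _ => Zp mm)) x),
        (∑ mm, Torus.realTrigPoly {K mm} (fun _ => Zp mm)) x⟫_ℝ :=
    integral_congr_ae (ae_of_all _ fun x => real_inner_comm _ _)
  rw [hcomm, inertial_modes hws]
  have hf : ∫ x, ⟪(∑ mm, Torus.realTrigPoly {KF mm} (fun _ => y)) x, w x⟫_ℝ =
      ∑ m, (⟪y, mFourierCoeff (EuclideanSpace.complexify ∘ w) (KF m)⟫_ℂ).re := by
    simp_rw [modes_apply, sum_inner]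
    rw [integral_finsetSum _ fun m _ =>
      ((continuous_mode _ _).inner hws.continuous).integrable_unitAddTorus]
    exact Finset.sum_congr rfl fun m _ => integral_inner_mode_left hwi _ _
  rw [hf]
  -- bookkeeping: `K 1 + K 0 = K 0 + K 1 = (0,2,0)`, `K 0 - K 1 = KF 0 = (0,0,2)`, `K 1 - K 0 = -KF 0`
  have e1 : K 1 + K 0 = K 0 + K 1 := add_comm _ _
  have e2 : K 0 - K 1 = KF 0 := by funext i; fin_cases i <;> simp [hK, hKF]
  have e3 : K 1 - K 0 = -KF 0 := by funext i; fin_cases i <;> simp [hK, hKF]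
  have hcs : mFourierCoeff (EuclideanSpace.complexify ∘ w) (-KF 0) =
      EuclideanSpace.conjVec (mFourierCoeff (EuclideanSpace.complexify ∘ w) (KF 0)) :=
    Torus.isConjSymm_mFourierCoeff hwi _
  have htA := hwd.sum_mul_mFourierCoeff_eq_zero hws (K 0 + K 1)
  have htB := hwd.sum_mul_mFourierCoeff_eq_zero hws (KF 0)
  simp only [Fin.sum_univ_two, Fin.sum_univ_one]
  rw [e1, e2, e3, hcs]
  set A := mFourierCoeff (EuclideanSpace.complexify ∘ w) (K 0 + K 1) with hA
  set B := mFourierCoeff (EuclideanSpace.complexify ∘ w) (KF 0) with hB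
  clear_value A B
  subst hK hZp hKF hy
  simp only [Fin.sum_univ_three, Matrix.cons_val, Pi.add_apply] at htA htB
  simp only [dotProduct, Fin.sum_univ_three, Pi.add_apply, Pi.sub_apply, Pi.neg_apply, Matrix.cons_val,
    PiLp.inner_apply, RCLike.inner_apply, EuclideanSpace.conjVec_apply]
  simp only [Int.cast_add, Int.cast_sub, Int.cast_neg, Int.cast_zero, Int.cast_one, Int.cast_ofNat]
    at htA htB ⊢
  have hA1 : A 1 = 0 := by linear_combination htA / 2
  have hB2 : B 2 = 0 := by linear_combination htB / 2
  simp only [hA1, hB2, map_zero, Complex.conj_conj]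
  simp [Complex.mul_re, Complex.mul_im, Complex.conj_re, Complex.conj_im, Complex.div_re, Complex.div_im]
  ring

/-- **The second-harmonic Kolmogorov force is not a witness, along a two-parameter trigonometric family.**
For all real `α γ`, `f = −παγ sin(4πx₃) e₁` (a real mode) is smooth, divergence free and mean zero, and the
`∀ v` clause of the crux fails at the smooth, divergence-free, mean-zero cellular field `V_{α,γ}`. -/
theorem cellular_not_witness (α γ : ℝ) :
    Torus.IsSmooth (∑ mm, Torus.realTrigPoly {(![![0, 0, 2]] : Fin 1 → Fin 3 → ℤ) mm}
        (fun _ => (WithLp.toLp 2 ![Complex.I * Real.pi * α * γ, 0, 0] : EuclideanSpace ℂ (Fin 3)))) ∧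
    Torus.IsDivFree (∑ mm, Torus.realTrigPoly {(![![0, 0, 2]] : Fin 1 → Fin 3 → ℤ) mm}
        (fun _ => (WithLp.toLp 2 ![Complex.I * Real.pi * α * γ, 0, 0] : EuclideanSpace ℂ (Fin 3)))) ∧
    Torus.HasZeroMean (∑ mm, Torus.realTrigPoly {(![![0, 0, 2]] : Fin 1 → Fin 3 → ℤ) mm}
        (fun _ => (WithLp.toLp 2 ![Complex.I * Real.pi * α * γ, 0, 0] : EuclideanSpace ℂ (Fin 3)))) ∧
    Torus.IsSmooth (∑ mm, Torus.realTrigPoly {(![![0, 1, 1], ![0, 1, -1]] : Fin 2 → Fin 3 → ℤ) mm}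
        (fun _ => (![WithLp.toLp 2 ![-Complex.I * α / 2, Complex.I * γ / 2, -Complex.I * γ / 2],
          WithLp.toLp 2 ![-Complex.I * α / 2, -Complex.I * γ / 2, -Complex.I * γ / 2]] : Fin 2 → EuclideanSpace ℂ (Fin 3)) mm)) ∧
    Torus.IsDivFree (∑ mm, Torus.realTrigPoly {(![![0, 1, 1], ![0, 1, -1]] : Fin 2 → Fin 3 → ℤ) mm}
        (fun _ => (![WithLp.toLp 2 ![-Complex.I * α / 2, Complex.I * γ / 2, -Complex.I * γ / 2],
          WithLp.toLp 2 ![-Complex.I * α / 2, -Complex.I * γ / 2, -Complex.I * γ / 2]] : Fin 2 → EuclideanSpace ℂ (Fin 3)) mm)) ∧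
    Torus.HasZeroMean (∑ mm, Torus.realTrigPoly {(![![0, 1, 1], ![0, 1, -1]] : Fin 2 → Fin 3 → ℤ) mm}
        (fun _ => (![WithLp.toLp 2 ![-Complex.I * α / 2, Complex.I * γ / 2, -Complex.I * γ / 2],
          WithLp.toLp 2 ![-Complex.I * α / 2, -Complex.I * γ / 2, -Complex.I * γ / 2]] : Fin 2 → EuclideanSpace ℂ (Fin 3)) mm)) ∧
    ∀ w : UnitAddTorus (Fin 3) → EuclideanSpace ℝ (Fin 3), Torus.IsSmooth w → Torus.IsDivFree w →
      Torus.HasZeroMean w →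
      ∫ x, ⟪Torus.convect
          (∑ mm, Torus.realTrigPoly {(![![0, 1, 1], ![0, 1, -1]] : Fin 2 → Fin 3 → ℤ) mm}
            (fun _ => (![WithLp.toLp 2 ![-Complex.I * α / 2, Complex.I * γ / 2, -Complex.I * γ / 2],
              WithLp.toLp 2 ![-Complex.I * α / 2, -Complex.I * γ / 2, -Complex.I * γ / 2]] :
              Fin 2 → EuclideanSpace ℂ (Fin 3)) mm))
          (∑ mm, Torus.realTrigPoly {(![![0, 1, 1], ![0, 1, -1]] : Fin 2 → Fin 3 → ℤ) mm}
            (fun _ => (![WithLp.toLp 2 ![-Complex.I * α / 2, Complex.I * γ / 2, -Complex.I * γ / 2],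
              WithLp.toLp 2 ![-Complex.I * α / 2, -Complex.I * γ / 2, -Complex.I * γ / 2]] :
              Fin 2 → EuclideanSpace ℂ (Fin 3)) mm)) x -
          (∑ mm, Torus.realTrigPoly {(![![0, 0, 2]] : Fin 1 → Fin 3 → ℤ) mm}
            (fun _ => (WithLp.toLp 2 ![Complex.I * Real.pi * α * γ, 0, 0] : EuclideanSpace ℂ (Fin 3)))) x,
          w x⟫_ℝ = 0 := by
  have hKF0 : ∀ m, (![![0, 0, 2]] : Fin 1 → Fin 3 → ℤ) m ≠ 0 := by
    intro m h
    fin_cases m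
    have := congrFun h 2; simp at this
  have hK0 : ∀ m, (![![0, 1, 1], ![0, 1, -1]] : Fin 2 → Fin 3 → ℤ) m ≠ 0 := by
    intro m h
    fin_cases m
    · have := congrFun h 1; simp at this
    · have := congrFun h 1; simp at this
  have hy' : ∀ m, ((fun j => (((![![0, 0, 2]] : Fin 1 → Fin 3 → ℤ) m) j : ℂ)) ⬝ᵥ
      (WithLp.ofLp (WithLp.toLp 2 ![Complex.I * Real.pi * α * γ, 0, 0] : EuclideanSpace ℂ (Fin 3)))) = 0 := by
    intro m; fin_cases m; simp [dotProduct, Fin.sum_univ_three]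
  have hZ' : ∀ m, ((fun j => (((![![0, 1, 1], ![0, 1, -1]] : Fin 2 → Fin 3 → ℤ) m) j : ℂ)) ⬝ᵥ
      (WithLp.ofLp ((![WithLp.toLp 2 ![-Complex.I * α / 2, Complex.I * γ / 2, -Complex.I * γ / 2],
        WithLp.toLp 2 ![-Complex.I * α / 2, -Complex.I * γ / 2, -Complex.I * γ / 2]] : Fin 2 → EuclideanSpace ℂ (Fin 3)) m))) = 0 := by
    intro m; fin_cases m <;> (simp [dotProduct, Fin.sum_univ_three]; try ring)
  exact ⟨isSmooth_modes _ _, isDivFree_modes _ _ hy', hasZeroMean_modes _ _ hKF0, isSmooth_modes _ _,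
    isDivFree_modes _ _ hZ', hasZeroMean_modes _ _ hK0, fun w hws hwd _ => cellular_quiet α γ rfl rfl rfl rfl w hws hwd⟩

end Summit.AnomalousDissipation.AnomalousDissipation.Theorems.SmoothEulerCoerciveForce.Negative
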